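import Literature.Topology.FourManifolds.SymplecticElementaryMoves
import Literature.Topology.FourManifolds.StandardTrisectionSlotSymmetry
import HarnessLib

/-!
# The elementary symplectic moves on `H₁(Σ_g; ℤ)` are induced by automorphisms of the surface
# group: the four local blocks (Zieschang–Vogt–Coldewey 3.6.7 (b), 3.6.9 (A)–(C))

Topic `Literature/Topology/FourManifolds`; theorems only, over `SurfaceGroupHomology.lean`
(`SurfaceGroup.abelianize`, the moves, `permHandles`), `SymplecticElementaryMoves.lean` and
`StandardTrisectionSlotSymmetry.lean` (`RelatorAut`, `toMulEquiv`, `blockSum`).  "`σ` realises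
`f`" is written out as `∀ s, toAdd (abelianize (σ s)) = f (toAdd (abelianize s))`.

* `move?_single_*` — the moves on basis vectors; `abelianize_comp_eq_of_apply_of`,
  `realises_mul`, `realises_inv` — realisation is checked on generators, closed under `∘`, `⁻¹`;
* `exists_realises_blockSum` — PLACEMENT: `refl ⊞ B ⊞ refl` (genus `n + k + n'`) realises any
  linear automorphism fixing the outer basis vectors and agreeing with `B` on the middle ones
  (through exponent sums, `lift_genInclAdd_genShiftAdd`);
* the four blocks, each a `RelatorAut` with explicit inverse, all free-group identities by
  `decide`: `exists_realises_moveX_mid` (`bᵢ ↦ bᵢaᵢ` induces `bᵢ ↦ bᵢ + aᵢ`, type (A)),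
  `exists_realises_moveY_mid` (`aᵢ ↦ aᵢbᵢ`), `exists_realises_moveZ_mid` (ZVC's `α`, p. 79:
  `t₁ ↦ t₁t₂, u₁ ↦ t₂⁻¹u₁t₂, t₂ ↦ t₂⁻¹u₁t₂u₁⁻¹t₂, u₂ ↦ u₂t₂⁻¹u₁⁻¹t₂`, "`α(∏[tᵢ,uᵢ]) = ∏[tᵢ,uᵢ]`,
  hence `α` is an automorphism", inducing type (C)), `exists_realises_swap_mid` (type (B)).
Sequel: `SurfaceGroupSymplecticRealisation.lean` (all handles, pairs, permutations, bases).

## References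

* H. Zieschang, E. Vogt, H.-D. Coldewey, *Surfaces and Planar Discontinuous Groups*, LNM 835,
  Springer (1980), §3.6: Thm. 3.6.7 (b), 3.6.9 (A)–(C), p. 79. [ZieschangVogtColdewey1980]
* J. Nielsen, *Untersuchungen zur Topologie …*, Acta Math. 50 (1927). [Nielsen1927]
-/

noncomputable section

namespace Literature.Topology.FourManifolds

open Finset

section Singles

variable {ι : Type*} [DecidableEq ι]

/-- `moveX` fixes `δ_x` unless `x = bᵢ`. [folklore] -/
theorem moveX_single_of_ne (i : ι) (c : ℤ) {x : ι × Bool} (hx : x ≠ (i, true)) (n : ℤ) :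
    moveX i c (Pi.single x n) = Pi.single x n :=
  moveX_eq_self c (Pi.single_eq_of_ne (Ne.symm hx) _)

/-- `moveX` on `δ_{bᵢ}`: `bᵢ ↦ bᵢ + c aᵢ`. [cite: ZieschangVogtColdewey1980, 3.6.9 (A)] -/
theorem moveX_single_true (i : ι) (c n : ℤ) :
    moveX i c (Pi.single (i, true) n) = Pi.single (i, true) n + c • Pi.single (i, false) n := by
  rw [moveX_apply, Pi.single_eq_same]

/-- `moveY` fixes `δ_x` unless `x = aᵢ`. [folklore] -/
theorem moveY_single_of_ne (i : ι) (c : ℤ) {x : ι × Bool} (hx : x ≠ (i, false)) (n : ℤ) :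
    moveY i c (Pi.single x n) = Pi.single x n :=
  moveY_eq_self c (Pi.single_eq_of_ne (Ne.symm hx) _)

/-- `moveY` on `δ_{aᵢ}`: `aᵢ ↦ aᵢ + c bᵢ`. [cite: ZieschangVogtColdewey1980, 3.6.9 (A)] -/
theorem moveY_single_false (i : ι) (c n : ℤ) :
    moveY i c (Pi.single (i, false) n) = Pi.single (i, false) n + c • Pi.single (i, true) n := by
  rw [moveY_apply, Pi.single_eq_same]

/-- `moveZ` fixes `δ_x` unless `x ∈ {aⱼ, bᵢ}`. [folklore] -/
theorem moveZ_single_of_ne {i j : ι} (h : i ≠ j) (c : ℤ) {x : ι × Bool} (hx : x ≠ (j, false))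
    (hx' : x ≠ (i, true)) (n : ℤ) : moveZ i j h c (Pi.single x n) = Pi.single x n :=
  moveZ_eq_self h c (Pi.single_eq_of_ne (Ne.symm hx) _) (Pi.single_eq_of_ne (Ne.symm hx') _)

/-- `moveZ` on `δ_{aⱼ}`: `aⱼ ↦ aⱼ + c aᵢ`. [cite: ZieschangVogtColdewey1980, 3.6.9 (C)] -/
theorem moveZ_single_false {i j : ι} (h : i ≠ j) (c n : ℤ) :
    moveZ i j h c (Pi.single (j, false) n) = Pi.single (j, false) n + c • Pi.single (i, false) n := by
  rw [moveZ_apply, Pi.single_eq_same, Pi.single_eq_of_ne (by simp), Pi.single_zero, sub_zero]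

/-- `moveZ` on `δ_{bᵢ}`: `bᵢ ↦ bᵢ - c bⱼ`. [cite: ZieschangVogtColdewey1980, 3.6.9 (C)] -/
theorem moveZ_single_true {i j : ι} (h : i ≠ j) (c n : ℤ) :
    moveZ i j h c (Pi.single (i, true) n) = Pi.single (i, true) n - c • Pi.single (j, true) n := by
  rw [moveZ_apply, Pi.single_eq_same, Pi.single_eq_of_ne (by simp), Pi.single_zero, zero_sub,
    smul_neg, sub_eq_add_neg]

/-- `moveW` fixes `δ_x` unless `x ∈ {bᵢ, bⱼ}`. [folklore] -/
theorem moveW_single_of_ne (i j : ι) (c : ℤ) {x : ι × Bool} (hx : x ≠ (i, true))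
    (hx' : x ≠ (j, true)) (n : ℤ) : moveW i j c (Pi.single x n) = Pi.single x n :=
  moveW_eq_self c (Pi.single_eq_of_ne (Ne.symm hx) _) (Pi.single_eq_of_ne (Ne.symm hx') _)

/-- `moveW` on `δ_{bᵢ}` (`i ≠ j`): `bᵢ ↦ bᵢ + c aⱼ`. [folklore] -/
theorem moveW_single_true_left {i j : ι} (h : i ≠ j) (c n : ℤ) :
    moveW i j c (Pi.single (i, true) n) = Pi.single (i, true) n + c • Pi.single (j, false) n := by
  have : ((j, true) : ι × Bool) ≠ (i, true) := by simpa using h.symm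
  rw [moveW_apply, Pi.single_eq_same, Pi.single_eq_of_ne this, Pi.single_zero, add_zero]

/-- `moveW` on `δ_{bⱼ}` (`i ≠ j`): `bⱼ ↦ bⱼ + c aᵢ`. [folklore] -/
theorem moveW_single_true_right {i j : ι} (h : i ≠ j) (c n : ℤ) :
    moveW i j c (Pi.single (j, true) n) = Pi.single (j, true) n + c • Pi.single (i, false) n := by
  have : ((i, true) : ι × Bool) ≠ (j, true) := by simpa using h
  rw [moveW_apply, Pi.single_eq_same, Pi.single_eq_of_ne this, Pi.single_zero, zero_add]

end Singles

section Realisation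

open Multiplicative

/-- Two additive characters of `S_g` through `abelianize`: if `σ` and `f` agree on generators
then `abelianize ∘ σ = f ∘ abelianize`. [folklore] -/
theorem abelianize_comp_eq_of_apply_of {g : ℕ} (σ : SurfaceGroup g ≃* SurfaceGroup g)
    (f : (surfaceGen g → ℤ) ≃ₗ[ℤ] (surfaceGen g → ℤ))
    (h : ∀ x : surfaceGen g,
      toAdd (SurfaceGroup.abelianize g (σ (PresentedGroup.of x))) = f (Pi.single x 1)) :
    ∀ s, toAdd (SurfaceGroup.abelianize g (σ s)) = f (toAdd (SurfaceGroup.abelianize g s)) := by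
  set F : SurfaceGroup g →* Multiplicative (surfaceGen g → ℤ) :=
    (AddMonoidHom.toMultiplicative f.toLinearMap.toAddMonoidHom).comp (SurfaceGroup.abelianize g)
    with hF
  have key : (SurfaceGroup.abelianize g).comp σ.toMonoidHom = F := by
    refine PresentedGroup.ext fun x => ?_
    rw [MonoidHom.comp_apply, MulEquiv.coe_toMonoidHom, hF, MonoidHom.comp_apply,
      SurfaceGroup.abelianize_of, AddMonoidHom.toMultiplicative_apply_apply, toAdd_ofAdd]
    exact congrArg ofAdd (h x)
  intro s
  have := DFunLike.congr_fun key s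
  rw [MonoidHom.comp_apply, MulEquiv.coe_toMonoidHom, hF, MonoidHom.comp_apply,
    AddMonoidHom.toMultiplicative_apply_apply] at this
  rw [this, toAdd_ofAdd]
  rfl

/-- Realisers compose: if `σ` realises `f` and `τ` realises `f'` then `σ ∘ τ` realises `f f'`.
[folklore] -/
theorem realises_mul {g : ℕ} {σ τ : SurfaceGroup g ≃* SurfaceGroup g}
    {f f' : (surfaceGen g → ℤ) ≃ₗ[ℤ] (surfaceGen g → ℤ)}
    (hσ : ∀ s, toAdd (SurfaceGroup.abelianize g (σ s)) = f (toAdd (SurfaceGroup.abelianize g s)))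
    (hτ : ∀ s, toAdd (SurfaceGroup.abelianize g (τ s)) = f' (toAdd (SurfaceGroup.abelianize g s))) :
    ∀ s, toAdd (SurfaceGroup.abelianize g ((τ.trans σ) s)) =
      (f * f') (toAdd (SurfaceGroup.abelianize g s)) := fun s => by
  rw [MulEquiv.trans_apply, hσ, hτ, linearEquiv_mul_apply]

/-- The inverse of a realiser realises the inverse. [folklore] -/
theorem realises_inv {g : ℕ} {σ : SurfaceGroup g ≃* SurfaceGroup g}
    {f : (surfaceGen g → ℤ) ≃ₗ[ℤ] (surfaceGen g → ℤ)}
    (hσ : ∀ s, toAdd (SurfaceGroup.abelianize g (σ s)) = f (toAdd (SurfaceGroup.abelianize g s))) :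
    ∀ s, toAdd (SurfaceGroup.abelianize g (σ.symm s)) = f⁻¹ (toAdd (SurfaceGroup.abelianize g s)) :=
  fun s => by
  have := hσ (σ.symm s)
  rw [σ.apply_symm_apply] at this
  rw [LinearEquiv.coe_inv, this, f.symm_apply_apply]

/-- Exponent sums through the middle-block embedding `F_k → F_{n+k+n'}` (`q ↦ (n + q)`-th handle):
the exponent-sum vector of the re-embedded word is the re-embedded exponent-sum vector.
[folklore] -/
theorem lift_genInclAdd_genShiftAdd (n k n' : ℕ) (w : FreeGroup (surfaceGen k)) :
    FreeGroup.lift (fun x : surfaceGen (n + k + n') => ofAdd (Pi.single x (1 : ℤ)))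
        (genInclAdd (n + k) n' (genShiftAdd n k w)) =
      FreeGroup.lift (fun q : surfaceGen k => ofAdd
        (Pi.single ((Fin.castAdd n' (Fin.natAdd n q.1), q.2) : surfaceGen (n + k + n')) (1 : ℤ))) w := by
  have key : (FreeGroup.lift (fun x : surfaceGen (n + k + n') => ofAdd (Pi.single x (1 : ℤ)))).comp
      ((genInclAdd (n + k) n').comp (genShiftAdd n k)) =
      FreeGroup.lift (fun q : surfaceGen k => ofAdd
        (Pi.single ((Fin.castAdd n' (Fin.natAdd n q.1), q.2) : surfaceGen (n + k + n')) (1 : ℤ))) :=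
    FreeGroup.ext_hom _ _ fun q => by simp
  exact DFunLike.congr_fun key w

/-- **Placement of a genus-`k` relator-fixing automorphism at handles `n, …, n+k-1` of genus
`n + k + n'`** (`refl ⊞ B ⊞ refl`, `StandardTrisectionSlotSymmetry.blockSum`): if a linear
automorphism `f` fixes the basis vectors of the outer handles and agrees with `B` on the middle
ones (through exponent sums), then `refl ⊞ B ⊞ refl` realises `f` on `H₁`. [folklore] -/
theorem exists_realises_blockSum {k : ℕ} (B : RelatorAut k) (n n' : ℕ)
    (f : (surfaceGen (n + k + n') → ℤ) ≃ₗ[ℤ] (surfaceGen (n + k + n') → ℤ))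
    (hincl : ∀ p : surfaceGen n,
      f (Pi.single (Fin.castAdd n' (Fin.castAdd k p.1), p.2) 1) =
        Pi.single (Fin.castAdd n' (Fin.castAdd k p.1), p.2) 1)
    (hshift : ∀ r : surfaceGen n',
      f (Pi.single (Fin.natAdd (n + k) r.1, r.2) 1) = Pi.single (Fin.natAdd (n + k) r.1, r.2) 1)
    (hmid : ∀ q : surfaceGen k, toAdd (FreeGroup.lift (fun q' : surfaceGen k => ofAdd
        (Pi.single ((Fin.castAdd n' (Fin.natAdd n q'.1), q'.2) : surfaceGen (n + k + n')) (1 : ℤ)))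
        (B.hom (FreeGroup.of q))) = f (Pi.single (Fin.castAdd n' (Fin.natAdd n q.1), q.2) 1)) :
    ∃ σ : SurfaceGroup (n + k + n') ≃* SurfaceGroup (n + k + n'),
      ∀ s, toAdd (SurfaceGroup.abelianize _ (σ s)) = f (toAdd (SurfaceGroup.abelianize _ s)) := by
  set A : RelatorAut (n + k + n') := (RelatorAut.refl.blockSum B).blockSum RelatorAut.refl with hA
  refine ⟨A.toMulEquiv, abelianize_comp_eq_of_apply_of _ _ fun x => ?_⟩
  have hmk : A.toMulEquiv (PresentedGroup.of x) = PresentedGroup.mk _ (A.hom (FreeGroup.of x)) :=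
    A.toMulEquiv_mk (FreeGroup.of x)
  rw [hmk, SurfaceGroup.abelianize_mk]
  rcases of_eq_genInclAdd_or_genShiftAdd x with ⟨y, hy⟩ | ⟨r, hr⟩
  · rcases of_eq_genInclAdd_or_genShiftAdd y with ⟨p, hp⟩ | ⟨q, hq⟩
    · -- an outer-left generator: fixed
      have hx : x = (Fin.castAdd n' (Fin.castAdd k p.1), p.2) := by
        rw [hp, genInclAdd_of, genInclAdd_of] at hy
        exact FreeGroup.of_injective hy
      have hhom : A.hom (FreeGroup.of x) = FreeGroup.of x := by
        rw [hy, hA, RelatorAut.blockSum_hom_genInclAdd, hp, RelatorAut.blockSum_hom_genInclAdd]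
        rfl
      rw [hhom, FreeGroup.lift_apply_of, toAdd_ofAdd, hx, hincl]
    · -- a middle generator: acted on by `B`
      have hx : x = (Fin.castAdd n' (Fin.natAdd n q.1), q.2) := by
        rw [hq, genShiftAdd_of, genInclAdd_of] at hy
        exact FreeGroup.of_injective hy
      have hhom : A.hom (FreeGroup.of x) = genInclAdd (n + k) n' (genShiftAdd n k (B.hom (FreeGroup.of q))) := by
        rw [hy, hA, RelatorAut.blockSum_hom_genInclAdd, hq, RelatorAut.blockSum_hom_genShiftAdd]
      rw [hhom, lift_genInclAdd_genShiftAdd, hmid, hx]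
  · -- an outer-right generator: fixed
    have hx : x = (Fin.natAdd (n + k) r.1, r.2) := by
      rw [genShiftAdd_of] at hr
      exact FreeGroup.of_injective hr
    have hhom : A.hom (FreeGroup.of x) = FreeGroup.of x := by
      rw [hr, hA, RelatorAut.blockSum_hom_genShiftAdd]
      rfl
    rw [hhom, FreeGroup.lift_apply_of, toAdd_ofAdd, hx, hshift]

/-- The first `n` handles of genus `n + k` differ from the last `k`. [folklore] -/
theorem castAdd_ne_natAdd' {n k : ℕ} (p : Fin n) (q : Fin k) :
    (Fin.castAdd k p : Fin (n + k)) ≠ Fin.natAdd n q := by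
  intro h
  have := congrArg Fin.val h
  simp only [Fin.val_castAdd, Fin.val_natAdd] at this
  omega

/-- The middle handles of genus `n + k + n'` differ from the outer-left ones. [folklore] -/
theorem castAdd_castAdd_ne_castAdd_natAdd {n k n' : ℕ} (p : Fin n) (q : Fin k) :
    (Fin.castAdd n' (Fin.castAdd k p) : Fin (n + k + n')) ≠ Fin.castAdd n' (Fin.natAdd n q) := by
  intro h
  have := congrArg Fin.val h
  simp only [Fin.val_castAdd, Fin.val_natAdd] at this
  omega

/-- The middle handles of genus `n + k + n'` differ from the outer-right ones. [folklore] -/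
theorem natAdd_ne_castAdd_natAdd {n k n' : ℕ} (r : Fin n') (q : Fin k) :
    (Fin.natAdd (n + k) r : Fin (n + k + n')) ≠ Fin.castAdd n' (Fin.natAdd n q) := by
  intro h
  have := congrArg Fin.val h
  simp only [Fin.val_castAdd, Fin.val_natAdd] at this
  omega

/-- ZVC 3.6.9 (A), first generator: the move `bᵢ ↦ bᵢ + aᵢ` of `H₁` is induced by the automorphism
`bᵢ ↦ bᵢaᵢ` of `S_g` (which fixes `[aᵢ, bᵢ]` on the nose), placed at handle `n` of genus
`n + 1 + n'`. [cite: ZieschangVogtColdewey1980, 3.6.9 (A)] -/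
theorem exists_realises_moveX_mid (n n' : ℕ) :
    ∃ σ : SurfaceGroup (n + 1 + n') ≃* SurfaceGroup (n + 1 + n'), ∀ s,
      toAdd (SurfaceGroup.abelianize _ (σ s)) =
        moveX (Fin.castAdd n' (Fin.natAdd n (0 : Fin 1))) 1 (toAdd (SurfaceGroup.abelianize _ s)) := by
  refine exists_realises_blockSum
    ⟨FreeGroup.lift fun x : surfaceGen 1 =>
        if x.2 = true then FreeGroup.of ((0 : Fin 1), true) * FreeGroup.of ((0 : Fin 1), false)
        else FreeGroup.of x,
      FreeGroup.lift fun x : surfaceGen 1 =>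
        if x.2 = true then FreeGroup.of ((0 : Fin 1), true) * (FreeGroup.of ((0 : Fin 1), false))⁻¹
        else FreeGroup.of x,
      by decide, by decide,
      FreeGroup.ext_hom _ _ (by decide), FreeGroup.ext_hom _ _ (by decide)⟩ n n' _
    (fun p => moveX_single_of_ne _ _ (by simp [castAdd_ne_natAdd']) _)
    (fun r => moveX_single_of_ne _ _ (by simp [natAdd_ne_castAdd_natAdd]) _) ?_
  rintro ⟨q, b⟩
  obtain rfl : q = 0 := Subsingleton.elim _ _
  cases b
  · simp [moveX_single_of_ne]
  · simp only [FreeGroup.lift_apply_of, if_true, map_mul, toAdd_mul, toAdd_ofAdd]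
    rw [moveX_single_true, one_smul]

/-- ZVC 3.6.9 (A), second generator: the move `aᵢ ↦ aᵢ + bᵢ` of `H₁` is induced by the
automorphism `aᵢ ↦ aᵢbᵢ` of `S_g`, placed at handle `n`. [cite: ZieschangVogtColdewey1980, 3.6.9 (A)] -/
theorem exists_realises_moveY_mid (n n' : ℕ) :
    ∃ σ : SurfaceGroup (n + 1 + n') ≃* SurfaceGroup (n + 1 + n'), ∀ s,
      toAdd (SurfaceGroup.abelianize _ (σ s)) =
        moveY (Fin.castAdd n' (Fin.natAdd n (0 : Fin 1))) 1 (toAdd (SurfaceGroup.abelianize _ s)) := by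
  refine exists_realises_blockSum
    ⟨FreeGroup.lift fun x : surfaceGen 1 =>
        if x.2 = false then FreeGroup.of ((0 : Fin 1), false) * FreeGroup.of ((0 : Fin 1), true)
        else FreeGroup.of x,
      FreeGroup.lift fun x : surfaceGen 1 =>
        if x.2 = false then FreeGroup.of ((0 : Fin 1), false) * (FreeGroup.of ((0 : Fin 1), true))⁻¹
        else FreeGroup.of x,
      by decide, by decide,
      FreeGroup.ext_hom _ _ (by decide), FreeGroup.ext_hom _ _ (by decide)⟩ n n' _
    (fun p => moveY_single_of_ne _ _ (by simp [castAdd_ne_natAdd']) _)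
    (fun r => moveY_single_of_ne _ _ (by simp [natAdd_ne_castAdd_natAdd]) _) ?_
  rintro ⟨q, b⟩
  obtain rfl : q = 0 := Subsingleton.elim _ _
  cases b
  · simp only [FreeGroup.lift_apply_of, if_true, map_mul, toAdd_mul, toAdd_ofAdd]
    rw [moveY_single_false, one_smul]
  · simp [moveY_single_of_ne]

/-- The middle handles `n`, `n + 1` of genus `n + 2 + n'` are distinct. [folklore] -/
theorem mid_one_ne_mid_zero (n n' : ℕ) :
    (Fin.castAdd n' (Fin.natAdd n (1 : Fin 2)) : Fin (n + 2 + n')) ≠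
      Fin.castAdd n' (Fin.natAdd n (0 : Fin 2)) := by
  intro h
  have := congrArg Fin.val h
  simp only [Fin.val_castAdd, Fin.val_natAdd] at this
  omega

/-- ZVC 3.6.9 (C): the move `aₙ ↦ aₙ + aₙ₊₁`, `bₙ₊₁ ↦ bₙ₊₁ - bₙ` of `H₁` (`moveZ (n+1) n 1`) is
induced by ZVC's automorphism `α : t₁ ↦ t₁t₂, u₁ ↦ t₂⁻¹u₁t₂, t₂ ↦ t₂⁻¹u₁t₂u₁⁻¹t₂,
u₂ ↦ u₂t₂⁻¹u₁⁻¹t₂` of `S_g` ("in the free group … `α(∏[tᵢ,uᵢ]) = ∏[tᵢ,uᵢ]`, hence `α` is an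
automorphism"), with inverse `t₁ ↦ t₁u₁⁻¹t₂⁻¹u₁, u₁ ↦ u₁⁻¹t₂u₁t₂⁻¹u₁, t₂ ↦ u₁⁻¹t₂u₁, u₂ ↦ u₂u₁`,
placed at handles `n, n+1` of genus `n + 2 + n'`. [cite: ZieschangVogtColdewey1980, 3.6.9 (C)] -/
theorem exists_realises_moveZ_mid (n n' : ℕ) :
    ∃ σ : SurfaceGroup (n + 2 + n') ≃* SurfaceGroup (n + 2 + n'), ∀ s,
      toAdd (SurfaceGroup.abelianize _ (σ s)) =
        moveZ (Fin.castAdd n' (Fin.natAdd n (1 : Fin 2))) (Fin.castAdd n' (Fin.natAdd n (0 : Fin 2)))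
          (mid_one_ne_mid_zero n n') 1 (toAdd (SurfaceGroup.abelianize _ s)) := by
  refine exists_realises_blockSum
    ⟨FreeGroup.lift fun x : surfaceGen 2 =>
        if x = ((0 : Fin 2), false) then FreeGroup.of ((0 : Fin 2), false) * FreeGroup.of ((1 : Fin 2), false)
        else if x = ((0 : Fin 2), true) then
          (FreeGroup.of ((1 : Fin 2), false))⁻¹ * FreeGroup.of ((0 : Fin 2), true) *
            FreeGroup.of ((1 : Fin 2), false)
        else if x = ((1 : Fin 2), false) then
          (FreeGroup.of ((1 : Fin 2), false))⁻¹ * FreeGroup.of ((0 : Fin 2), true) *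
            FreeGroup.of ((1 : Fin 2), false) * (FreeGroup.of ((0 : Fin 2), true))⁻¹ *
            FreeGroup.of ((1 : Fin 2), false)
        else FreeGroup.of ((1 : Fin 2), true) * (FreeGroup.of ((1 : Fin 2), false))⁻¹ *
            (FreeGroup.of ((0 : Fin 2), true))⁻¹ * FreeGroup.of ((1 : Fin 2), false),
      FreeGroup.lift fun x : surfaceGen 2 =>
        if x = ((0 : Fin 2), false) then
          FreeGroup.of ((0 : Fin 2), false) * (FreeGroup.of ((0 : Fin 2), true))⁻¹ *
            (FreeGroup.of ((1 : Fin 2), false))⁻¹ * FreeGroup.of ((0 : Fin 2), true)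
        else if x = ((0 : Fin 2), true) then
          (FreeGroup.of ((0 : Fin 2), true))⁻¹ * FreeGroup.of ((1 : Fin 2), false) *
            FreeGroup.of ((0 : Fin 2), true) * (FreeGroup.of ((1 : Fin 2), false))⁻¹ *
            FreeGroup.of ((0 : Fin 2), true)
        else if x = ((1 : Fin 2), false) then
          (FreeGroup.of ((0 : Fin 2), true))⁻¹ * FreeGroup.of ((1 : Fin 2), false) *
            FreeGroup.of ((0 : Fin 2), true)
        else FreeGroup.of ((1 : Fin 2), true) * FreeGroup.of ((0 : Fin 2), true),
      by decide, by decide,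
      FreeGroup.ext_hom _ _ (by decide), FreeGroup.ext_hom _ _ (by decide)⟩ n n' _
    (fun p => moveZ_single_of_ne _ _ (by simp [castAdd_ne_natAdd'])
      (by simp [castAdd_ne_natAdd']) _)
    (fun r => moveZ_single_of_ne _ _ (by simp [natAdd_ne_castAdd_natAdd])
      (by simp [natAdd_ne_castAdd_natAdd]) _) ?_
  have h10 := mid_one_ne_mid_zero n n'
  rintro ⟨q, b⟩
  fin_cases q <;> cases b
  · -- `a₀ ↦ a₀ a₁`, `δ_{a₀} ↦ δ_{a₀} + δ_{a₁}`
    simp only [FreeGroup.lift_apply_of, Fin.zero_eta, Fin.isValue, if_true, map_mul, toAdd_mul,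
      toAdd_ofAdd]
    rw [moveZ_single_false, one_smul]
  · -- `b₀ ↦ a₁⁻¹ b₀ a₁`, `δ_{b₀}` fixed
    simp only [FreeGroup.lift_apply_of, Fin.zero_eta, Fin.isValue, Prod.mk.injEq,
      Bool.true_eq_false, and_false, if_false, if_true, map_mul, map_inv, toAdd_mul,
      toAdd_inv, toAdd_ofAdd]
    rw [moveZ_single_of_ne _ _ (by simp) (by simp [h10.symm])]
    abel
  · -- `a₁ ↦ a₁⁻¹ b₀ a₁ b₀⁻¹ a₁`, `δ_{a₁}` fixed
    simp only [FreeGroup.lift_apply_of, Fin.mk_one, Fin.isValue, Prod.mk.injEq, one_ne_zero,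
      if_false, and_true, if_true, map_mul, map_inv, toAdd_mul, toAdd_inv, toAdd_ofAdd,
      Bool.false_eq_true, and_self]
    rw [moveZ_single_of_ne _ _ (by simp [h10]) (by simp)]
    abel
  · -- `b₁ ↦ b₁ a₁⁻¹ b₀⁻¹ a₁`, `δ_{b₁} ↦ δ_{b₁} - δ_{b₀}`
    simp only [FreeGroup.lift_apply_of, Fin.mk_one, Fin.isValue, Prod.mk.injEq, one_ne_zero,
      false_and, if_false, Bool.true_eq_false, and_false, map_mul, map_inv, toAdd_mul, toAdd_inv,
      toAdd_ofAdd]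
    rw [moveZ_single_true, one_smul]
    abel

/-- ZVC 3.6.9 (B): the transposition of the handles `n`, `n + 1` on `H₁` is induced by the
relator-fixing handle transposition `aₙ ↦ [aₙ,bₙ]aₙ₊₁[aₙ,bₙ]⁻¹`, `bₙ ↦ [aₙ,bₙ]bₙ₊₁[aₙ,bₙ]⁻¹`,
`aₙ₊₁ ↦ aₙ`, `bₙ₊₁ ↦ bₙ` of `S_g` (as `RelatorAut.swp` in genus 3), placed at handles `n, n+1`
of genus `n + 2 + n'`. [cite: ZieschangVogtColdewey1980, 3.6.9 (B)] -/
theorem exists_realises_swap_mid (n n' : ℕ) :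
    ∃ σ : SurfaceGroup (n + 2 + n') ≃* SurfaceGroup (n + 2 + n'), ∀ s,
      toAdd (SurfaceGroup.abelianize _ (σ s)) =
        permHandles (Equiv.swap (Fin.castAdd n' (Fin.natAdd n (0 : Fin 2)))
          (Fin.castAdd n' (Fin.natAdd n (1 : Fin 2)))) (toAdd (SurfaceGroup.abelianize _ s)) := by
  refine exists_realises_blockSum
    ⟨FreeGroup.lift fun x : surfaceGen 2 =>
        if x.1 = 0 then
          FreeGroup.of ((0 : Fin 2), false) * FreeGroup.of ((0 : Fin 2), true) *
            (FreeGroup.of ((0 : Fin 2), false))⁻¹ * (FreeGroup.of ((0 : Fin 2), true))⁻¹ *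
            FreeGroup.of ((1 : Fin 2), x.2) *
            (FreeGroup.of ((0 : Fin 2), false) * FreeGroup.of ((0 : Fin 2), true) *
              (FreeGroup.of ((0 : Fin 2), false))⁻¹ * (FreeGroup.of ((0 : Fin 2), true))⁻¹)⁻¹
        else FreeGroup.of ((0 : Fin 2), x.2),
      FreeGroup.lift fun x : surfaceGen 2 =>
        if x.1 = 0 then FreeGroup.of ((1 : Fin 2), x.2)
        else (FreeGroup.of ((1 : Fin 2), false) * FreeGroup.of ((1 : Fin 2), true) *
              (FreeGroup.of ((1 : Fin 2), false))⁻¹ * (FreeGroup.of ((1 : Fin 2), true))⁻¹)⁻¹ *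
            FreeGroup.of ((0 : Fin 2), x.2) *
            (FreeGroup.of ((1 : Fin 2), false) * FreeGroup.of ((1 : Fin 2), true) *
              (FreeGroup.of ((1 : Fin 2), false))⁻¹ * (FreeGroup.of ((1 : Fin 2), true))⁻¹),
      by decide, by decide,
      FreeGroup.ext_hom _ _ (by decide), FreeGroup.ext_hom _ _ (by decide)⟩ n n' _
    (fun p => by
      rw [permHandles_single, Equiv.swap_apply_of_ne_of_ne (castAdd_castAdd_ne_castAdd_natAdd _ _)
        (castAdd_castAdd_ne_castAdd_natAdd _ _)])
    (fun r => by
      rw [permHandles_single, Equiv.swap_apply_of_ne_of_ne (natAdd_ne_castAdd_natAdd _ _)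
        (natAdd_ne_castAdd_natAdd _ _)]) ?_
  rintro ⟨q, b⟩
  fin_cases q
  · simp only [FreeGroup.lift_apply_of, Fin.zero_eta, Fin.isValue, if_true, map_mul, map_inv,
      toAdd_mul, toAdd_inv, toAdd_ofAdd]
    rw [permHandles_single, Equiv.swap_apply_left]
    abel
  · simp only [FreeGroup.lift_apply_of, Fin.mk_one, Fin.isValue, one_ne_zero, if_false, toAdd_ofAdd]
    rw [permHandles_single, Equiv.swap_apply_right]

end Realisation

end Literature.Topology.FourManifolds

end
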